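import Summits.BirchSwinnertonDyer.BirchSwinnertonDyer.Theses.GenusKolyvaginAtTwo
import Summits.BirchSwinnertonDyer.BirchSwinnertonDyer.Theorems.GenusKolyvaginAtTwoLeafCensusShaCellSplit
import Summits.BirchSwinnertonDyer.BirchSwinnertonDyer.Theorems.GenusKolyvaginAtTwoDeepWitnessDefs
import Summits.BirchSwinnertonDyer.BirchSwinnertonDyer.Theorems.GenusKolyvaginAtTwoPowDvdShaCardAtTwoRT
import Summits.BirchSwinnertonDyer.BirchSwinnertonDyer.Theorems.GenusKolyvaginAtTwoEquivariantChebotarevAtTwoR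
import Summits.BirchSwinnertonDyer.BirchSwinnertonDyer.Theorems.GenusKolyvaginAtTwoCyclicTorsionOfNegDisc
import Summits.BirchSwinnertonDyer.BirchSwinnertonDyer.Theorems.GenusKolyvaginAtTwoKolyvaginExclusionsOfHeegner
import HarnessLib

/-!
# LINE 42 «kolyvagin_structure» — skeleton for the Ш-cell crux `RankOneShaCellBSDTwo` (stmt-BirchSwinnertonDyer-27477,
# route `GenusKolyvaginAtTwo` rev 72) — v1.3 (idea-crit-5 #657 MUST-FIX paid: U1♯⁻ carries the binder `(d₁ : KolyvaginHeegnerData Dt β ι 1)`;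
# otherwise = v1.2: ALIGNMENT (751)(3): the `Δ < 0` habitat sub-cell CLOSED mod Q2 by the route's L_T over LEAD's
# `HasDeepKolyvaginWitnessAtTwo`), SEVEN stubs: ITEMS-BY-NAME (WALL row 1 ∧ Q2) · DIV|Ш · U1♯⁻ (deep-witness supply on the habitat) · STRUCT₂|off · U1♯|off · RESIDUAL · PRINT×6

Ideator bsd-idea-1 g30 (technique card «compactness–contradiction / rigidity»; director focus: beyond-print theorems at `2`).  The SECOND line of
the generation on the Ш-cell, with a lever no Ш-cell / twin-cell line uses: **Kolyvagin's STRUCTURE THEOREM** (Math. Ann. 1991) transported to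
`p = 2`.  LINE 23 / LEAD v0.1 / LINE 41 treat the LOWER half of KEX⁰|Ш (`4^{M₀} ∣ #Ш(W_K)[2^∞]·4^t`) as a black box («NDIV|Ш»); here it is OPENED:

* STRUCT₂ (`KolyvaginStructureLowerAtTwo`, research L, print for odd `p`): Kolyvagin's derivative classes `c_M(n)` are explicit elements; if at
  every deep level some class of depth `r` has defect `≤ m` then **`4^{M₀−m} ∣ #Ш(W_K)[2^∞]`** (the rigidity: the filtration `m₀ ≥ m₁ ≥ … ≥ m_∞`
  of Kolyvagin's system DETERMINES `#Ш[2^∞] = 4^{m₀ − m_∞}` — a discrete invariant that cannot move continuously, read off finitely many classes).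
* U1♯ (`SharpKolyvaginDefectShaCellAtTwo`, research XL — THE residual): the defect is attained SHARPLY at the Tamagawa–Manin exponent
  `t = ord₂ c + ord₂ C(W)` — U1 of route KRR (stmt-28083, `KolyvaginBoundedDefectAtTwo`: «∃ m») with `m` PINNED to `t`.  This is the `2`-adic
  W. Zhang theorem; Jetchev's divisibility explains `m_∞ ≥ t`, KEX⁰|Ш is `m_∞ = t`.
* RESIDUAL (`SmallImageLowerShaCellAtTwo`): the lower half on the finite list of non-surjective `2`-adic images (Rouse–Zureick-Brown), declared.

* v1.2 — HABITAT SIMPLIFICATION (LEAD gk2-p1 g32 ALIGNMENT memo §3, idea-crit-5 #644): on the `Δ < 0` HABITAT sub-cell of a Ш-cell frame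
  (`C(W)` odd, an odd multiplicative prime, `Δ_W < 0`, `Dt.c` odd — `IsOddNegHabitatFrameAtTwo`) with full `2`-adic image, the lower half
  `4^{M₀} ∣ #Ш(W_K)[2^∞]` is the route's CLOSED L_T `powDvdShaCardAtTwoRT_proof` (item 23659; fed Q2 = item 24880 BY NAME, Q5R
  `GenusExact.equivariantChebotarevAtTwoR_proof` CLOSED, Q1 `GenusCyclicTorsion.cyclicTorsionOfNegDisc_proof` CLOSED) applied to ONE deep
  POINT-LEVEL witness `HasDeepKolyvaginWitnessAtTwo W K Dt β ι` (LEAD p811931, the route's verbatim clause of `K4Neg` 31526 / SUPPLY⁻): new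
  research SUPPLY stub U1♯⁻ (`DeepWitnessSupplyShaCellNegHabitatAtTwo` = the Ш-cell twin of K₄⁻: W. Zhang's sharp non-vanishing `m_∞ = 0` at
  `2` when `t = 0`), new CLOSED piece `lower_onNegHabitat_of_deepWitness` (kernel, no sorry).  STRUCT₂ / U1♯ (class-level, defect `t`) are now
  needed only OFF that sub-cell (`Δ_W > 0`, even `C(W)`, no odd multiplicative prime, or `Dt.c` even) — binders `¬ IsOddNegHabitatFrameAtTwo W Dt`.

So **hSha ⟸ (WALL row 1 ∧ Q2) + DIV|Ш + U1♯⁻ + STRUCT₂|off + U1♯|off + RESIDUAL + PRINT×6**, composition `RankOneShaCellBSDTwo_of` (sorry-free outside the seven `stub_*`),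
through LEAD g32's engine p801119 exactly as LINE 41.  WHAT THIS LINE SAYS TO THE LADDER: the Ш-cell's lower half IS Kolyvagin non-vanishing at `2`
with sharp exponent (KRR's currency U1, pinned) + the structure theorem at `2`; the upper half stays DIV|Ш (LINE 41 v1.3 splits it as K-ANN₁ + SQ).
The two lines are complementary cuts of the same KEX⁰|Ш: LINE 41 cuts by RESTRICTION (ℚ ↔ K; provable RIG/RIG⁺; slack locus = order-`4` elements
of `Ш(W)`), LINE 42 cuts by DEPTH (Kolyvagin's filtration).

INSTRUMENT ROW THAT WOULD REFUTE THE KEY LEMMA: a Ш-cell frame with surjective `2`-adic image where a first Kolyvagin class `c_M(ℓ)` (depth 1,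
`M = M(ℓ)`) has defect `m(ℓ) < t` (order `> 2^{M−t}`): then STRUCT₂ gives `#Ш(W_K)[2^∞] ≥ 4^{M₀−t+1}`, contradicting DIV|Ш — so STRUCT₂ ∧ DIV|Ш
predict **every Kolyvagin class at `2` is `2^t`-divisible** (Jetchev's theorem at `2`, unproved), checkable on curves with `∏ c_q` even.
CHEAPEST FALSIFIER of U1♯: a Ш-cell curve with `t = 0` (39077b1, 40581c1: `∏ c_q` odd, optimal so `c = 1`) and its first Kolyvagin primes `ℓ`
with `c_{M(ℓ)}(ℓ)` computed to be `0` at full level and all small depths — Kolyvagin-class computations à la Jetchev–Lauter–Stein 2009 (odd `p`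
in print; none at `2`).

BSD is NOT proved by this.  No summit / rung / crux / stub is proved by filing this; the `stub_*` are the obligations.
-/

set_option linter.dupNamespace false -- `Summit.<P>.<Sub>` repeats `BirchSwinnertonDyer` (D-0017)

namespace Summit.BirchSwinnertonDyer.BirchSwinnertonDyer.Cruxes.RankOneShaCellBSDTwo.KolyvaginStructure

open scoped Classical NumberField

open Summit.BirchSwinnertonDyer.BirchSwinnertonDyer.Theses.GenusKolyvaginAtTwo
open WeierstrassCurve NumberField Literature.NumberTheory.EllipticCurves Literature.NumberTheory.EllipticCurves.ModularForms
open Summit.BirchSwinnertonDyer.BirchSwinnertonDyer.Theorems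
open Summit.BirchSwinnertonDyer.BirchSwinnertonDyer.Theorems.GenusExact.Census.ShaCell
  (shaCell_of_wall_of_friedbergHoffstein_of_kex0Sha_of_facts kex0Sha_of_shaCell_of_wall_of_facts)
open Summit.BirchSwinnertonDyer.BirchSwinnertonDyer.Theorems.GenusExact.TwinSwap.Ledger.Line25
  (not_isOfFinAddOrder_derivedPoint_one_of_rankOne_of_lValue_ne_zero)
open Summit.BirchSwinnertonDyer.BirchSwinnertonDyer.Theorems.KolyvaginAtTwo (exists_exactTwoDepth)
open Summit.BirchSwinnertonDyer.BirchSwinnertonDyer.Theorems.GenusExact.DeepWitness (HasDeepKolyvaginWitnessAtTwo)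
open Summit.BirchSwinnertonDyer.BirchSwinnertonDyer.Theorems.GenusExact (kolyvaginExclusions_of_odd_of_satisfiesHeegnerHypothesis)
open Summit.BirchSwinnertonDyer.BirchSwinnertonDyer.Theses.ByReductionTypeAtTwo
  (GoodOrdinaryRankZeroAtTwo MultiplicativeRankZeroAtTwo SupersingularRankZeroAtTwo AdditiveRankZeroAtTwo)

/-! ## Displayed Props -/

/-- S1′ · the ANCHOR: BSD₂ for every non-CM globally minimal curve of analytic rank `0` (= WALL row 1 of `ByReductionTypeAtTwo`, four reduction types). -/
def RankZeroBSDTwo : Prop :=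
  ∀ (W : WeierstrassCurve ℚ) [W.IsElliptic] [W.IsGloballyMinimal], ¬ W.HasCM → W.analyticRank = 0 →
    Literature.NumberTheory.EllipticCurves.BSDp W 2

/-- KEX⁰|Ш (LEAD g32, p801119's hypothesis `hKEX0Sha`, VERBATIM): the `2`-primary Gross–Zagier index relation for the Ш-cell member at every odd
Heegner frame with `2` split and `L(W^{(d_K)},1) ≠ 0`.  DERIVED below from DIV|Ш (upper) + the lower half, itself from STRUCT₂ + U1♯ (+ the small-image residual); displayed because the engine consumes this text. -/
def HeegnerIndexRelationShaCellAtTwo : Prop :=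
  ∀ (W : WeierstrassCurve ℚ) [W.IsElliptic] [W.IsGloballyMinimal] [NeZero (W.conductorNorm ℤ)],
    ¬ W.HasCM → W.analyticRank = 1 → (∀ P : W.toAffine.Point, 2 • P = 0 → P = 0) → Nat.card (W.selmerGroup 2) ≠ 2 →
    ∀ (K : Type) [Field K] [NumberField K], IsImaginaryQuadratic K →
      Odd (NumberField.discr K) → NumberField.discr K ≠ -3 → SatisfiesHeegnerHypothesis (W.conductorNorm ℤ) K →
      ((Ideal.span {(2 : ℤ)}).primesOver (𝓞 K)).ncard = 2 →
      ∀ (Wd : WeierstrassCurve ℚ) [Wd.IsElliptic] [Wd.IsGloballyMinimal],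
        (∃ C : VariableChange ℚ, C • W.quadraticTwist (NumberField.discr K : ℚ) = Wd) →
      (W.quadraticTwist (NumberField.discr K : ℚ)).entireLFunction 1 ≠ 0 →
      ∀ (Dt : ModularParametrizationData W (W.conductorNorm ℤ)) (β : ℤ) (ι : K →+* ℂ) (d₁ : KolyvaginHeegnerData Dt β ι 1),
        ∃ M₀ : ℕ,
          (∃ Q : (W.baseChange (ringClassField K ι 1)).toAffine.Point, ((2 ^ M₀ : ℕ) : ℤ) • Q = d₁.derivedPoint) ∧
          (¬ ∃ Q : (W.baseChange (ringClassField K ι 1)).toAffine.Point, ((2 ^ (M₀ + 1) : ℕ) : ℤ) • Q = d₁.derivedPoint) ∧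
          Nat.card (AddCommGroup.primaryComponent (W.baseChange K).sha 2) *
              2 ^ (2 * (padicValInt 2 Dt.c + padicValNat 2 W.tamagawaProduct)) = 2 ^ (2 * M₀)

/-- DIV|Ш · THE UPPER HALF on the Ш-cell (product-form Kolyvagin–Gross–Jetchev bound at `2` for the rank-one member, NO `2`-adic image hypothesis):
at every frame of KEX⁰|Ш and EVERY exact `2`-depth `M₀` of `P(1)`: **`#Ш(W_K)[2^∞] · 4^{ord₂ c + ord₂ C(W)} ∣ 4^{M₀}`**.  Beyond print at `2`
(Kolyvagin 1990 / Gross 1991 §5 give `#Ш(W_K)[p^∞] ∣ p^{2M₀}` for `p` odd outside the image-deficient set; Jetchev 2008 adds `m_max` for odd `p`). -/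
def HeegnerIndexUpperShaCellAtTwo : Prop :=
  ∀ (W : WeierstrassCurve ℚ) [W.IsElliptic] [W.IsGloballyMinimal] [NeZero (W.conductorNorm ℤ)],
    ¬ W.HasCM → W.analyticRank = 1 → (∀ P : W.toAffine.Point, 2 • P = 0 → P = 0) → Nat.card (W.selmerGroup 2) ≠ 2 →
    ∀ (K : Type) [Field K] [NumberField K], IsImaginaryQuadratic K →
      Odd (NumberField.discr K) → NumberField.discr K ≠ -3 → SatisfiesHeegnerHypothesis (W.conductorNorm ℤ) K →
      ((Ideal.span {(2 : ℤ)}).primesOver (𝓞 K)).ncard = 2 →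
      ∀ (Wd : WeierstrassCurve ℚ) [Wd.IsElliptic] [Wd.IsGloballyMinimal],
        (∃ C : VariableChange ℚ, C • W.quadraticTwist (NumberField.discr K : ℚ) = Wd) →
      (W.quadraticTwist (NumberField.discr K : ℚ)).entireLFunction 1 ≠ 0 →
      ∀ (Dt : ModularParametrizationData W (W.conductorNorm ℤ)) (β : ℤ) (ι : K →+* ℂ) (d₁ : KolyvaginHeegnerData Dt β ι 1) (M₀ : ℕ),
        (∃ Q : (W.baseChange (ringClassField K ι 1)).toAffine.Point, ((2 ^ M₀ : ℕ) : ℤ) • Q = d₁.derivedPoint) →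
        (¬ ∃ Q : (W.baseChange (ringClassField K ι 1)).toAffine.Point, ((2 ^ (M₀ + 1) : ℕ) : ℤ) • Q = d₁.derivedPoint) →
          Nat.card (AddCommGroup.primaryComponent (W.baseChange K).sha 2) *
              2 ^ (2 * (padicValInt 2 Dt.c + padicValNat 2 W.tamagawaProduct)) ∣ 2 ^ (2 * M₀)

/-- The LOWER HALF on the Ш-cell in plain form: at every frame and exact `2`-depth `M₀` of `P(1)`, **`4^{M₀} ∣ #Ш(W_K)[2^∞] · 4^{ord₂ c + ord₂ C(W)}`**.
DERIVED below (`lower_of_supply_of_structure_of_sharp_of_residual`) from U1♯⁻ + L_T on the `Δ < 0` habitat sub-cell (mod Q2), from STRUCT₂|off + U1♯|off elsewhere on the surjective-image locus, and from the declared residual off it;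
displayed because it is the second half of KEX⁰|Ш.  (As a claim it is beyond print at `2`; for `p ≥ 5` it is W. Zhang's theorem.) -/
def HeegnerIndexLowerShaCellAtTwo : Prop :=
  ∀ (W : WeierstrassCurve ℚ) [W.IsElliptic] [W.IsGloballyMinimal] [NeZero (W.conductorNorm ℤ)],
    ¬ W.HasCM → W.analyticRank = 1 → (∀ P : W.toAffine.Point, 2 • P = 0 → P = 0) → Nat.card (W.selmerGroup 2) ≠ 2 →
    ∀ (K : Type) [Field K] [NumberField K], IsImaginaryQuadratic K →
      Odd (NumberField.discr K) → NumberField.discr K ≠ -3 → SatisfiesHeegnerHypothesis (W.conductorNorm ℤ) K →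
      ((Ideal.span {(2 : ℤ)}).primesOver (𝓞 K)).ncard = 2 →
      ∀ (Wd : WeierstrassCurve ℚ) [Wd.IsElliptic] [Wd.IsGloballyMinimal],
        (∃ C : VariableChange ℚ, C • W.quadraticTwist (NumberField.discr K : ℚ) = Wd) →
      (W.quadraticTwist (NumberField.discr K : ℚ)).entireLFunction 1 ≠ 0 →
      ∀ (Dt : ModularParametrizationData W (W.conductorNorm ℤ)) (β : ℤ) (ι : K →+* ℂ) (d₁ : KolyvaginHeegnerData Dt β ι 1) (M₀ : ℕ),
        (∃ Q : (W.baseChange (ringClassField K ι 1)).toAffine.Point, ((2 ^ M₀ : ℕ) : ℤ) • Q = d₁.derivedPoint) →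
        (¬ ∃ Q : (W.baseChange (ringClassField K ι 1)).toAffine.Point, ((2 ^ (M₀ + 1) : ℕ) : ℤ) • Q = d₁.derivedPoint) →
          2 ^ (2 * M₀) ∣ Nat.card (AddCommGroup.primaryComponent (W.baseChange K).sha 2) * 2 ^ (2 * (padicValInt 2 Dt.c + padicValNat 2 W.tamagawaProduct))

/-- v1.2 · THE `Δ < 0` HABITAT SUB-CELL of a Ш-cell frame `(W, Dt)` — the antecedents of the route's CLOSED lower half L_T (`PowDvdShaCardAtTwoRT`,
item 23659) that are properties of the curve and the parametrisation datum: `C(W)` odd, an ODD prime of MULTIPLICATIVE reduction, `Δ_W < 0`, and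
`Dt.c` odd (so the Tamagawa–Manin exponent `t = ord₂ c + ord₂ C(W)` is `0`; Kolyvagin's two field exclusions follow from `d_K` odd + Heegner by
`kolyvaginExclusions_of_odd_of_satisfiesHeegnerHypothesis`).  A predicate, nothing asserted. -/
def IsOddNegHabitatFrameAtTwo (W : WeierstrassCurve ℚ) [W.IsElliptic] [W.IsGloballyMinimal] [NeZero (W.conductorNorm ℤ)]
    (Dt : ModularParametrizationData W (W.conductorNorm ℤ)) : Prop :=
  Odd W.tamagawaProduct ∧
    (∃ v : IsDedekindDomain.HeightOneSpectrum (𝓞 ℚ), ((2 : ℕ) : 𝓞 ℚ) ∉ v.asIdeal ∧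
      ((W.conductorNorm ℤ : ℕ) : 𝓞 ℚ) ∈ v.asIdeal ∧ W.HasMultiplicativeReductionAt v) ∧
    W.Δ < 0 ∧ Odd Dt.c

/-- U1♯⁻ · DEEP-WITNESS SUPPLY ON THE Ш-CELL'S `Δ < 0` HABITAT (v1.2; research, beyond print at `2` — the Ш-cell twin of the route's `K4Neg`
(stmt-31526) / gk2-p2's SUPPLY⁻, in LEAD's shared currency `HasDeepKolyvaginWitnessAtTwo` (p811931)): at every Ш-cell frame (`r_an(W) = 1`,
`W(ℚ)[2] = 0`, `#Sel₂(W) ≠ 2`; `K` odd Heegner with `2` split and `L(W^{(d_K)},1) ≠ 0`) lying on the habitat sub-cell with FULL `2`-adic image,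
there is ONE square-free product `n` of deep `Frob_∞`-Kolyvagin primes with `P(n) ∉ 2·W(K[n])`.  This is W. Zhang's sharp non-vanishing
`m_∞ = 0` (his Thm. 1.1 for `p ≥ 5`, `p ∤ C(W)`) transported to `p = 2` at Tamagawa–Manin exponent `t = 0`; by L_T it yields `4^{M₀} ∣ #Ш(W_K)[2^∞]`
(closed piece `lower_onNegHabitat_of_deepWitness`).  `n = 1` is allowed by the text but impossible here (`M₀ ≥ 1` on the Ш-cell: forced co-depth).
WHY IT MIGHT FAIL: at `2` the Kolyvagin primes with `Frob_ℓ = Frob_∞` and `4 ∣ a_ℓ, ℓ+1` may all give `2`-divisible `P(n)` for some `W` (an `H¹(K(W[4])/K, W[4])`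
obstruction invisible for odd `p`); instrument: the «deep point witness at 2» engine (ALIGNMENT §5). [cite: WZhang2014, Thm. 1.1] [cite: Kolyvagin1991MathAnn, Conj. A]
v1.3 (idea-crit-5 #657 MUST-FIX): the binder `(_d₁ : KolyvaginHeegnerData Dt β ι 1)` makes `(β, ι)` a COMPATIBLE Heegner datum
(`4N ∣ β² − d_K` via `dvd_sq_sub`); without it the bare `∀ β` said the habitat is empty (`crit_U1_emptiesHabitat`).
[cite: McCallumLMS1991, §5 Thm. 5.4] -/
def DeepWitnessSupplyShaCellNegHabitatAtTwo : Prop :=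
  ∀ (W : WeierstrassCurve ℚ) [W.IsElliptic] [W.IsGloballyMinimal] [NeZero (W.conductorNorm ℤ)],
    ¬ W.HasCM → W.analyticRank = 1 → (∀ P : W.toAffine.Point, 2 • P = 0 → P = 0) → Nat.card (W.selmerGroup 2) ≠ 2 →
    ∀ (K : Type) [Field K] [NumberField K], IsImaginaryQuadratic K →
      Odd (NumberField.discr K) → NumberField.discr K ≠ -3 → SatisfiesHeegnerHypothesis (W.conductorNorm ℤ) K →
      ((Ideal.span {(2 : ℤ)}).primesOver (𝓞 K)).ncard = 2 →
      ∀ (Wd : WeierstrassCurve ℚ) [Wd.IsElliptic] [Wd.IsGloballyMinimal],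
        (∃ C : VariableChange ℚ, C • W.quadraticTwist (NumberField.discr K : ℚ) = Wd) →
      (W.quadraticTwist (NumberField.discr K : ℚ)).entireLFunction 1 ≠ 0 →
      ∀ (Dt : ModularParametrizationData W (W.conductorNorm ℤ)) (β : ℤ) (ι : K →+* ℂ) (_d₁ : KolyvaginHeegnerData Dt β ι 1),
        (∀ k : ℕ, W.HasSurjectiveModNGaloisRep (2 ^ k : ℕ)) → IsOddNegHabitatFrameAtTwo W Dt →
          HasDeepKolyvaginWitnessAtTwo W K Dt β ι

/-- STRUCT₂ · KOLYVAGIN'S STRUCTURE THEOREM AT `2`, LOWER-BOUND HALF (the lever) — v1.1 FINITE-LEVEL FORM, v1.2 OFF THE `Δ < 0` HABITAT SUB-CELL: on a Ш-cell frame with full `2`-adic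
image, if ONE Kolyvagin conductor `n` at ONE level `M` with `M₀ + m < M ≤ M(n)` carries a class `c_M(n)` of DEFECT `≤ m` — order `≥ 2^{M−m}`, i.e.
`2^{M−m−1}·c_M(n) ≠ 0`, equivalently Kolyvagin's `m(n) ≤ m` (`ord c_M(n) = 2^{M − m(n)}` for every `M ≤ M(n)` once `W(K_n)[2] = 0`, so the
condition does not depend on `M`) — then **`4^{M₀−m} ∣ #Ш(W_K)[2^∞]`** (`M₀` = exact `2`-depth of `P(1)`; one witness gives Kolyvagin's
`m_∞ = inf_r min_n m(n) ≤ m(n) ≤ m`, and `#Ш[p^∞] = p^{2(m₀−m_∞)}` by the structure theorem `Ш[p^∞]^± ≅ ⊕ (ℤ/p^{m_{i−1}−m_i})²`, the minima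
running over squarefree Kolyvagin conductors of level `> m₀ = M₀` [MatarNekovar2019, Thm. 0.7]).  No depth `r`, no cofinality in `M`: a single
witness needs no prime swap.  In print for ODD `p` with surjective image
[Kolyvagin1991MathAnn, Thm. 1] [McCallumLMS1991, §5]; at `p = 2` the `±`-eigenspace bookkeeping and `H¹(K(E[2^M])/K, E[2^M])` are the known
frictions — research, size L.  The classes are the tree's `KolyvaginHeegnerData.kolyvaginClass`, in U1's currency (route KRR, stmt-28083). -/
def KolyvaginStructureLowerOffHabitatAtTwo : Prop :=
  ∀ (W : WeierstrassCurve ℚ) [W.IsElliptic] [W.IsGloballyMinimal] [NeZero (W.conductorNorm ℤ)],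
    ¬ W.HasCM → W.analyticRank = 1 → (∀ P : W.toAffine.Point, 2 • P = 0 → P = 0) → Nat.card (W.selmerGroup 2) ≠ 2 →
    ∀ (K : Type) [Field K] [NumberField K], IsImaginaryQuadratic K →
      Odd (NumberField.discr K) → NumberField.discr K ≠ -3 → SatisfiesHeegnerHypothesis (W.conductorNorm ℤ) K →
      ((Ideal.span {(2 : ℤ)}).primesOver (𝓞 K)).ncard = 2 →
      ∀ (Wd : WeierstrassCurve ℚ) [Wd.IsElliptic] [Wd.IsGloballyMinimal],
        (∃ C : VariableChange ℚ, C • W.quadraticTwist (NumberField.discr K : ℚ) = Wd) →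
      (W.quadraticTwist (NumberField.discr K : ℚ)).entireLFunction 1 ≠ 0 →
      ∀ (Dt : ModularParametrizationData W (W.conductorNorm ℤ)) (β : ℤ) (ι : K →+* ℂ) (d₁ : KolyvaginHeegnerData Dt β ι 1) (M₀ : ℕ),
        (∃ Q : (W.baseChange (ringClassField K ι 1)).toAffine.Point, ((2 ^ M₀ : ℕ) : ℤ) • Q = d₁.derivedPoint) →
        (¬ ∃ Q : (W.baseChange (ringClassField K ι 1)).toAffine.Point, ((2 ^ (M₀ + 1) : ℕ) : ℤ) • Q = d₁.derivedPoint) →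
        (∀ k : ℕ, W.HasSurjectiveModNGaloisRep (2 ^ k : ℕ)) → ¬ IsOddNegHabitatFrameAtTwo W Dt →
        ∀ m : ℕ, (∃ (M n : ℕ) (d : KolyvaginHeegnerData Dt β ι n), M₀ + m < M ∧
              KolyvaginDescent.KolSupp (Zhang2014.IsKolyvaginPrime (W.conductorNorm ℤ) W K 2) n ∧
              ((M : ℕ) : ℕ∞) ≤ Zhang2014.levelIndex W 2 n ∧ (2 ^ (M - m - 1) : ℤ) • d.kolyvaginClass Nat.prime_two M ≠ 0) →
          2 ^ (2 * (M₀ - m)) ∣ Nat.card (AddCommGroup.primaryComponent (W.baseChange K).sha 2)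

/-- U1♯ · SHARP KOLYVAGIN DEFECT AT `2` on the Ш-cell, v1.2 OFF THE `Δ < 0` HABITAT SUB-CELL (binder `¬ IsOddNegHabitatFrameAtTwo W Dt`; on the
sub-cell the point-level U1♯⁻ replaces it): on a Ш-cell frame with full `2`-adic image, U1's
conclusion (`KolyvaginBoundedDefectAtTwo`, stmt-BirchSwinnertonDyer-28083: some depth `r`, bounded defect `m`, at every deep level) holds with the
defect PINNED to the Tamagawa–Manin exponent **`m = t := ord₂ c + ord₂ C(W)`** — v1.1 FINITE-LEVEL FORM: SOME Kolyvagin conductor `n` at SOME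
level `M` with `M₀ + t < M ≤ M(n)` has a class `c_M(n)` of order `≥ 2^{M−t}` (`m(n) ≤ t`; one witness, no cofinality — strictly weaker than v1.0's
«at every deep level», which needed the prime swap that is lossy at `2`).  Why `t`: Kolyvagin classes are globally divisible by the Tamagawa exponent (Jetchev 2008, odd `p`), so `m_∞ ≥ t`; KEX⁰|Ш says
`m_∞ = t` exactly.  For `p ≥ 5`, `p ∤` Tamagawa, this is W. Zhang's theorem (`m = 0`) [WZhang2014, Thm. 1.1]; at `2` it is Kolyvagin's conjecture
with sharp exponent — beyond print, XL; its bounded form is U1 (LINES 17/39/40 of route KRR).  [cite: Kolyvagin1991MathAnn, Conj. A]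
[cite: Jetchev2008, Thm. 1.1] -/
def SharpKolyvaginDefectOffHabitatAtTwo : Prop :=
  ∀ (W : WeierstrassCurve ℚ) [W.IsElliptic] [W.IsGloballyMinimal] [NeZero (W.conductorNorm ℤ)],
    ¬ W.HasCM → W.analyticRank = 1 → (∀ P : W.toAffine.Point, 2 • P = 0 → P = 0) → Nat.card (W.selmerGroup 2) ≠ 2 →
    ∀ (K : Type) [Field K] [NumberField K], IsImaginaryQuadratic K →
      Odd (NumberField.discr K) → NumberField.discr K ≠ -3 → SatisfiesHeegnerHypothesis (W.conductorNorm ℤ) K →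
      ((Ideal.span {(2 : ℤ)}).primesOver (𝓞 K)).ncard = 2 →
      ∀ (Wd : WeierstrassCurve ℚ) [Wd.IsElliptic] [Wd.IsGloballyMinimal],
        (∃ C : VariableChange ℚ, C • W.quadraticTwist (NumberField.discr K : ℚ) = Wd) →
      (W.quadraticTwist (NumberField.discr K : ℚ)).entireLFunction 1 ≠ 0 →
      ∀ (Dt : ModularParametrizationData W (W.conductorNorm ℤ)) (β : ℤ) (ι : K →+* ℂ) (d₁ : KolyvaginHeegnerData Dt β ι 1) (M₀ : ℕ),
        (∃ Q : (W.baseChange (ringClassField K ι 1)).toAffine.Point, ((2 ^ M₀ : ℕ) : ℤ) • Q = d₁.derivedPoint) →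
        (¬ ∃ Q : (W.baseChange (ringClassField K ι 1)).toAffine.Point, ((2 ^ (M₀ + 1) : ℕ) : ℤ) • Q = d₁.derivedPoint) →
        (∀ k : ℕ, W.HasSurjectiveModNGaloisRep (2 ^ k : ℕ)) → ¬ IsOddNegHabitatFrameAtTwo W Dt →
          (∃ (M n : ℕ) (d : KolyvaginHeegnerData Dt β ι n), M₀ + (padicValInt 2 Dt.c + padicValNat 2 W.tamagawaProduct) < M ∧
              KolyvaginDescent.KolSupp (Zhang2014.IsKolyvaginPrime (W.conductorNorm ℤ) W K 2) n ∧
              ((M : ℕ) : ℕ∞) ≤ Zhang2014.levelIndex W 2 n ∧ (2 ^ (M - (padicValInt 2 Dt.c + padicValNat 2 W.tamagawaProduct) - 1) : ℤ) • d.kolyvaginClass Nat.prime_two M ≠ 0)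

/-- RESIDUAL · the lower half on the SMALL-IMAGE locus of the Ш-cell (non-CM, `W(ℚ)[2] = 0`, but `ρ_{W,2^k}` not onto for some `k` — by
Rouse–Zureick-Brown 2015 a finite list of `2`-adic images, all without fixed vectors mod `2`): declared residual of this line, research; Kolyvagin's
machinery with non-surjective image carries extra `H¹(K(E[2^M])/K, E[2^M])` defects that the structure theorem does not control.
[cite: RouseZureickBrown2015, Thm. 1.1] -/
def SmallImageLowerShaCellAtTwo : Prop :=
  ∀ (W : WeierstrassCurve ℚ) [W.IsElliptic] [W.IsGloballyMinimal] [NeZero (W.conductorNorm ℤ)],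
    ¬ W.HasCM → W.analyticRank = 1 → (∀ P : W.toAffine.Point, 2 • P = 0 → P = 0) → Nat.card (W.selmerGroup 2) ≠ 2 →
    ∀ (K : Type) [Field K] [NumberField K], IsImaginaryQuadratic K →
      Odd (NumberField.discr K) → NumberField.discr K ≠ -3 → SatisfiesHeegnerHypothesis (W.conductorNorm ℤ) K →
      ((Ideal.span {(2 : ℤ)}).primesOver (𝓞 K)).ncard = 2 →
      ∀ (Wd : WeierstrassCurve ℚ) [Wd.IsElliptic] [Wd.IsGloballyMinimal],
        (∃ C : VariableChange ℚ, C • W.quadraticTwist (NumberField.discr K : ℚ) = Wd) →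
      (W.quadraticTwist (NumberField.discr K : ℚ)).entireLFunction 1 ≠ 0 →
      ∀ (Dt : ModularParametrizationData W (W.conductorNorm ℤ)) (β : ℤ) (ι : K →+* ℂ) (d₁ : KolyvaginHeegnerData Dt β ι 1) (M₀ : ℕ),
        (∃ Q : (W.baseChange (ringClassField K ι 1)).toAffine.Point, ((2 ^ M₀ : ℕ) : ℤ) • Q = d₁.derivedPoint) →
        (¬ ∃ Q : (W.baseChange (ringClassField K ι 1)).toAffine.Point, ((2 ^ (M₀ + 1) : ℕ) : ℤ) • Q = d₁.derivedPoint) →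
        (¬ ∀ k : ℕ, W.HasSurjectiveModNGaloisRep (2 ^ k : ℕ)) →
          2 ^ (2 * M₀) ∣ Nat.card (AddCommGroup.primaryComponent (W.baseChange K).sha 2) * 2 ^ (2 * (padicValInt 2 Dt.c + padicValNat 2 W.tamagawaProduct))

/-! ## The seven stubs -/

/-- stub ITEMS-BY-NAME = WALL row 1 — items `GoodOrdinaryRankZeroAtTwo` (19095), `MultiplicativeRankZeroAtTwo` (19096), `SupersingularRankZeroAtTwo`
(19097), `AdditiveRankZeroAtTwo` (19098) of route `ByReductionTypeAtTwo` (the four support binders of GK2's `closes`) — AND Q2 = item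
`KolyvaginRelationAtTwo` (stmt-BirchSwinnertonDyer-24880, GK2 support, OPEN; the one antecedent of the closed L_T not yet proved), all BY NAME. -/
theorem stub_itemsByName :
    (GoodOrdinaryRankZeroAtTwo ∧ MultiplicativeRankZeroAtTwo ∧ SupersingularRankZeroAtTwo ∧ AdditiveRankZeroAtTwo) ∧ KolyvaginRelationAtTwo := by
  sorry

/-- stub DIV|Ш — the upper half on the Ш-cell (research; beyond print at `2`; shared verbatim with LINE 23 / LINE 41 / LEAD v0.1). -/
theorem stub_heegnerIndexUpperShaCell : HeegnerIndexUpperShaCellAtTwo := by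
  sorry

/-- stub U1♯⁻ — ONE deep point-level Kolyvagin witness at every Ш-cell frame on the `Δ < 0` habitat sub-cell with full `2`-adic image (v1.2; research,
beyond print at `2`; LEAD's shared currency `HasDeepKolyvaginWitnessAtTwo`). -/
theorem stub_deepWitnessSupplyNegHabitat : DeepWitnessSupplyShaCellNegHabitatAtTwo := by
  sorry

/-- stub STRUCT₂|off — Kolyvagin's structure theorem at `2`, lower-bound half, OFF the habitat sub-cell (research-grade L; print for odd `p`). -/
theorem stub_kolyvaginStructureLowerOffHabitat : KolyvaginStructureLowerOffHabitatAtTwo := by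
  sorry

/-- stub U1♯|off — sharp Kolyvagin defect `t` at `2` on the Ш-cell OFF the habitat sub-cell (research XL; in U1's currency). -/
theorem stub_sharpKolyvaginDefectOffHabitat : SharpKolyvaginDefectOffHabitatAtTwo := by
  sorry

/-- stub RESIDUAL — the lower half on the small-`2`-adic-image locus (declared residual; research). -/
theorem stub_smallImageLower : SmallImageLowerShaCellAtTwo := by
  sorry

/-- stub PRINT = the route's print items BY NAME — `GrossZagierAllLevels` (24148), `MultPublishedInputsAtTwo` (19921 = GZK), `EntireLFunctionRat`
(19273), `MilneAnyModel` (24149) — + BCDT `nonempty_modularParametrizationData` + Friedberg–Hoffstein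
`friedbergHoffstein_exists_heegnerField_split_twist_ne_zero` (Literature statement-only facts, in print). -/
theorem stub_printFacts :
    GrossZagierAllLevels ∧ MultPublishedInputsAtTwo ∧ EntireLFunctionRat ∧ MilneAnyModel ∧ nonempty_modularParametrizationData ∧
      friedbergHoffstein_exists_heegnerField_split_twist_ne_zero := by
  sorry

/-! ## Closed pieces (kernel-checked, no sorry) -/

/-- WALL row 1 (ByReductionTypeAtTwo 19095–19098) ⟹ S1′, by the reduction-type tetrachotomy at `2`. [folklore] -/
theorem rankZeroBSDTwo_of_wall (hOrd : GoodOrdinaryRankZeroAtTwo) (hMult : MultiplicativeRankZeroAtTwo)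
    (hSS : SupersingularRankZeroAtTwo) (hAdd : AdditiveRankZeroAtTwo) : RankZeroBSDTwo := by
  intro W _ _ hCM hr
  by_cases hg : W.HasGoodReductionAtPrime 2
  · by_cases hd : ((2 : ℕ) : ℤ) ∣ W.frobeniusTrace 2
    · exact hSS W hCM hr ⟨hg, hd⟩
    · exact hOrd W hCM hr ⟨hg, hd⟩
  · by_cases hm : W.HasMultiplicativeReductionAtPrime 2
    · exact hMult W hCM hr hm
    · exact hAdd W hCM hr ⟨hg, hm⟩

/-- **v1.2 CLOSED PIECE — the lower half ON THE `Δ < 0` HABITAT SUB-CELL from ONE deep witness, modulo Q2** (kernel, no sorry): the route's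
closed L_T `powDvdShaCardAtTwoRT_proof` (item 23659), fed Q2, the CLOSED Q5R `GenusExact.equivariantChebotarevAtTwoR_proof` and the CLOSED Q1
`GenusCyclicTorsion.cyclicTorsionOfNegDisc_proof`, read for the rank-one Ш-cell member (L_T's text has no root-number and no Selmer binder); `P(1)`
is of infinite order by Gross–Zagier at an `L(W^{(d_K)},1) ≠ 0` frame; Kolyvagin's two exclusions by `kolyvaginExclusions_of_odd_of_satisfiesHeegnerHypothesis`.
Conclusion in the Ш-cell's shifted shape `4^{M₀} ∣ #Ш(W_K)[2^∞]·4^t` (here `4^{M₀} ∣ #Ш(W_K)[2^∞]` already).  CONDITIONAL on Q2 + the witness.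
[cite: Kolyvagin1991MathAnn, Thm. 1] [cite: McCallumLMS1991, §5 Thm. 5.4, Thm. 5.8] [cite: GrossZagier1986, V.§2 (2.2)] -/
theorem lower_onNegHabitat_of_deepWitness (hQ2 : KolyvaginRelationAtTwo)
    (hGZ : ∀ (N : ℕ) [NeZero N] (W : WeierstrassCurve ℚ) (K : Type) [Field K] [NumberField K], gross_zagier N W K)
    (hmod : hasEntireLFunction_rat)
    (W : WeierstrassCurve ℚ) [W.IsElliptic] [W.IsGloballyMinimal] [NeZero (W.conductorNorm ℤ)] (hcm : ¬ W.HasCM)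
    (hr : W.analyticRank = 1)
    (K : Type) [Field K] [NumberField K] (hK : IsImaginaryQuadratic K) (hodd : Odd (NumberField.discr K))
    (h3 : NumberField.discr K ≠ -3) (hH : SatisfiesHeegnerHypothesis (W.conductorNorm ℤ) K)
    (hLv : (W.quadraticTwist (NumberField.discr K : ℚ)).entireLFunction 1 ≠ 0)
    (Dt : ModularParametrizationData W (W.conductorNorm ℤ)) (β : ℤ) (ι : K →+* ℂ) (d₁ : KolyvaginHeegnerData Dt β ι 1) (M₀ : ℕ)
    (hdiv : ∃ Q : (W.baseChange (ringClassField K ι 1)).toAffine.Point, ((2 ^ M₀ : ℕ) : ℤ) • Q = d₁.derivedPoint)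
    (hndiv : ¬ ∃ Q : (W.baseChange (ringClassField K ι 1)).toAffine.Point, ((2 ^ (M₀ + 1) : ℕ) : ℤ) • Q = d₁.derivedPoint)
    (himg : ∀ k : ℕ, W.HasSurjectiveModNGaloisRep (2 ^ k : ℕ)) (hhab : IsOddNegHabitatFrameAtTwo W Dt)
    (hwit : HasDeepKolyvaginWitnessAtTwo W K Dt β ι) :
    2 ^ (2 * M₀) ∣ Nat.card (AddCommGroup.primaryComponent (W.baseChange K).sha 2) *
      2 ^ (2 * (padicValInt 2 Dt.c + padicValNat 2 W.tamagawaProduct)) := by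
  obtain ⟨hT, ⟨v, h2v, hNv, hmult⟩, hneg, _hc⟩ := hhab
  obtain ⟨n, d, hn, hdeep, hPn⟩ := hwit
  have hy : ¬ IsOfFinAddOrder d₁.derivedPoint :=
    not_isOfFinAddOrder_derivedPoint_one_of_rankOne_of_lValue_ne_zero hmod W K (hGZ _ W K) hK hH hr hLv d₁
  obtain ⟨hsq1, hsq2⟩ := kolyvaginExclusions_of_odd_of_satisfiesHeegnerHypothesis W hK hodd hH
  have hρ : ∀ n : ℕ, 0 < n → W.HasSurjectiveModNGaloisRep ((2 : ℤ) ^ n) := fun k _ ↦ by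
    simpa using himg k
  have hL := powDvdShaCardAtTwoRT_proof hQ2 GenusExact.equivariantChebotarevAtTwoR_proof GenusCyclicTorsion.cyclicTorsionOfNegDisc_proof
    W hcm hT v h2v hNv hmult hneg K hK hodd h3 hH hsq1 hsq2 hρ Dt β ι d₁ hy M₀ hdiv hndiv n d hn hdeep hPn
  exact Dvd.dvd.mul_right hL _

/-- **LOWER ⟸ U1♯⁻ (habitat, via L_T mod Q2) + STRUCT₂|off + U1♯|off (+ residual)**: on the habitat sub-cell the closed piece above; off it, with
sharp defect `t`, the structure theorem gives `4^{M₀−t} ∣ #Ш(W_K)[2^∞]`, hence `4^{M₀} ∣ #Ш(W_K)[2^∞]·4^t`; off the surjective-image locus the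
residual stub is the statement itself.  CONDITIONAL. [folklore] -/
theorem lower_of_supply_of_structure_of_sharp_of_residual (hQ2 : KolyvaginRelationAtTwo)
    (hGZ : ∀ (N : ℕ) [NeZero N] (W : WeierstrassCurve ℚ) (K : Type) [Field K] [NumberField K], gross_zagier N W K)
    (hmod : hasEntireLFunction_rat)
    (hHab : DeepWitnessSupplyShaCellNegHabitatAtTwo) (hS : KolyvaginStructureLowerOffHabitatAtTwo)
    (hU : SharpKolyvaginDefectOffHabitatAtTwo) (hRes : SmallImageLowerShaCellAtTwo) : HeegnerIndexLowerShaCellAtTwo := by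
  intro W _ _ _ hcm hr hT2 hSel K _ _ hK hodd h3 hH h2K Wd _ _ hWd hLv Dt β ι d₁ M₀ hdiv hndiv
  by_cases himg : ∀ k : ℕ, W.HasSurjectiveModNGaloisRep (2 ^ k : ℕ)
  · by_cases hhab : IsOddNegHabitatFrameAtTwo W Dt
    · exact lower_onNegHabitat_of_deepWitness hQ2 hGZ hmod W hcm hr K hK hodd h3 hH hLv Dt β ι d₁ M₀ hdiv hndiv himg hhab
        (hHab W hcm hr hT2 hSel K hK hodd h3 hH h2K Wd hWd hLv Dt β ι d₁ himg hhab)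
    · have hlow := hS W hcm hr hT2 hSel K hK hodd h3 hH h2K Wd hWd hLv Dt β ι d₁ M₀ hdiv hndiv himg hhab
        (padicValInt 2 Dt.c + padicValNat 2 W.tamagawaProduct)
        (hU W hcm hr hT2 hSel K hK hodd h3 hH h2K Wd hWd hLv Dt β ι d₁ M₀ hdiv hndiv himg hhab)
      -- `4^(M₀ - t) ∣ #Ш` ⇒ `4^M₀ ∣ #Ш · 4^t`
      have h2 : 2 ^ (2 * M₀) ∣ 2 ^ (2 * (M₀ - (padicValInt 2 Dt.c + padicValNat 2 W.tamagawaProduct))) *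
          2 ^ (2 * (padicValInt 2 Dt.c + padicValNat 2 W.tamagawaProduct)) := by
        rw [← pow_add]; exact Nat.pow_dvd_pow 2 (by omega)
      exact dvd_trans h2 (Nat.mul_dvd_mul_right hlow _)
  · exact hRes W hcm hr hT2 hSel K hK hodd h3 hH h2K Wd hWd hLv Dt β ι d₁ M₀ hdiv hndiv himg

/-- **KEX⁰|Ш ⟸ DIV|Ш + LOWER** (exact depth exists by Gross–Zagier non-torsion + Mordell–Weil over `K[1]`; then antisymmetry).  CONDITIONAL. [folklore] -/
theorem kexSha_of_upper_of_lower
    (hGZ : ∀ (N : ℕ) [NeZero N] (W : WeierstrassCurve ℚ) (K : Type) [Field K] [NumberField K], gross_zagier N W K)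
    (hmod : hasEntireLFunction_rat)
    (hUp : HeegnerIndexUpperShaCellAtTwo) (hLow : HeegnerIndexLowerShaCellAtTwo) :
    HeegnerIndexRelationShaCellAtTwo := by
  intro W _ _ _ hcm hr hT2 hSel K _ _ hK hodd h3 hH h2K Wd _ _ hWd hLv Dt β ι d₁
  have hy : ¬ IsOfFinAddOrder d₁.derivedPoint :=
    not_isOfFinAddOrder_derivedPoint_one_of_rankOne_of_lValue_ne_zero hmod W K (hGZ _ W K) hK hH hr hLv d₁
  haveI := (finiteDimensional_and_isGalois_ringClassField hK ι one_ne_zero).1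
  haveI : NumberField (ringClassField K ι 1) := NumberField.of_module_finite K _
  haveI : (W.baseChange (ringClassField K ι 1)).IsElliptic := by rw [baseChange]; infer_instance
  haveI : Module.Finite ℤ (W.baseChange (ringClassField K ι 1)).toAffine.Point := by
    convert (W.baseChange (ringClassField K ι 1)).module_finite_point_holds
  obtain ⟨M₀, hdiv, hndiv⟩ := exists_exactTwoDepth
    (A := (W.baseChange (ringClassField K ι 1)).toAffine.Point) (y := d₁.derivedPoint) (by convert hy)
  exact ⟨M₀, hdiv, hndiv, Nat.dvd_antisymm (hUp W hcm hr hT2 hSel K hK hodd h3 hH h2K Wd hWd hLv Dt β ι d₁ M₀ hdiv hndiv)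
    (hLow W hcm hr hT2 hSel K hK hodd h3 hH h2K Wd hWd hLv Dt β ι d₁ M₀ hdiv hndiv)⟩

/-- Uniqueness of the exact `2`-depth of a point (used for losslessness). [folklore] -/
theorem exactTwoDepth_unique {A : Type*} [AddCommGroup A] {y : A} {a b : ℕ}
    (ha : ∃ Q : A, ((2 ^ a : ℕ) : ℤ) • Q = y) (ha' : ¬ ∃ Q : A, ((2 ^ (a + 1) : ℕ) : ℤ) • Q = y)
    (hb : ∃ Q : A, ((2 ^ b : ℕ) : ℤ) • Q = y) (hb' : ¬ ∃ Q : A, ((2 ^ (b + 1) : ℕ) : ℤ) • Q = y) : a = b := by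
  by_contra hab
  rcases Nat.lt_or_gt_of_ne hab with h | h
  · obtain ⟨Q, hQ⟩ := hb
    exact ha' ⟨((2 ^ (b - (a + 1)) : ℕ) : ℤ) • Q, by
      rw [smul_smul, ← hQ]; congr 1; rw [← Nat.cast_mul, ← pow_add]; congr 2; omega⟩
  · obtain ⟨Q, hQ⟩ := ha
    exact hb' ⟨((2 ^ (a - (b + 1)) : ℕ) : ℤ) • Q, by
      rw [smul_smul, ← hQ]; congr 1; rw [← Nat.cast_mul, ← pow_add]; congr 2; omega⟩

/-- **DIV|Ш and LOWER are LOSSLESS**: KEX⁰|Ш ⟹ both (uniqueness of the exact depth); with the LEAD's converse `kex0Sha_of_shaCell_of_wall_of_facts`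
(crux + S1′ + PRINT ⟹ KEX⁰|Ш) neither is stronger than the crux modulo wall and print. [folklore] -/
theorem halves_of_kexSha (hKEX : HeegnerIndexRelationShaCellAtTwo) :
    HeegnerIndexUpperShaCellAtTwo ∧ HeegnerIndexLowerShaCellAtTwo := by
  refine ⟨?_, ?_⟩
  · intro W _ _ _ hcm hr hT2 hSel K _ _ hK hodd h3 hH h2K Wd _ _ hWd hLv Dt β ι d₁ M₀ hdiv hndiv
    obtain ⟨M₁, hdiv₁, hndiv₁, heq⟩ := hKEX W hcm hr hT2 hSel K hK hodd h3 hH h2K Wd hWd hLv Dt β ι d₁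
    rw [exactTwoDepth_unique hdiv hndiv hdiv₁ hndiv₁, ← heq]
  · intro W _ _ _ hcm hr hT2 hSel K _ _ hK hodd h3 hH h2K Wd _ _ hWd hLv Dt β ι d₁ M₀ hdiv hndiv
    obtain ⟨M₁, hdiv₁, hndiv₁, heq⟩ := hKEX W hcm hr hT2 hSel K hK hodd h3 hH h2K Wd hWd hLv Dt β ι d₁
    rw [exactTwoDepth_unique hdiv hndiv hdiv₁ hndiv₁, ← heq]

/-- ★ crux + S1′ + PRINT ⟹ both halves (LEAD g32's lossless converse p801119).  CONDITIONAL. -/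
theorem halves_of_shaCell_of_wall_of_facts
    (hGZ : ∀ (N : ℕ) [NeZero N] (W : WeierstrassCurve ℚ) (K : Type) [Field K] [NumberField K], gross_zagier N W K)
    (hGZK : rank_eq_analyticRank_of_analyticRank_le_one) (hmod : hasEntireLFunction_rat)
    (hMilneC : Milne1972.bsdQuotient_baseChange_quadratic_anyModel) (h1 : RankZeroBSDTwo)
    (hCell : Summit.BirchSwinnertonDyer.BirchSwinnertonDyer.Theses.GenusKolyvaginAtTwo.RankOneShaCellBSDTwo) :
    HeegnerIndexUpperShaCellAtTwo ∧ HeegnerIndexLowerShaCellAtTwo :=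
  halves_of_kexSha (kex0Sha_of_shaCell_of_wall_of_facts hGZ hGZK hmod hMilneC h1 hCell)

/-! ## The composition -/

/-- COMPOSITION with displayed inputs (kernel-checked): S1′ + Q2 + DIV|Ш + U1♯⁻ + STRUCT₂|off + U1♯|off + RESIDUAL + PRINT×6 prove the Ш-cell text via
LEAD g32's engine `shaCell_of_wall_of_friedbergHoffstein_of_kex0Sha_of_facts`, KEX⁰|Ш := `kexSha_of_upper_of_lower`. -/
theorem shaCell_of_inputs (h1 : RankZeroBSDTwo) (hQ2 : KolyvaginRelationAtTwo) (hUp : HeegnerIndexUpperShaCellAtTwo)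
    (hHab : DeepWitnessSupplyShaCellNegHabitatAtTwo) (hS : KolyvaginStructureLowerOffHabitatAtTwo)
    (hD : SharpKolyvaginDefectOffHabitatAtTwo) (hRes : SmallImageLowerShaCellAtTwo)
    (hGZ : GrossZagierAllLevels) (hGZK : MultPublishedInputsAtTwo) (hLf : EntireLFunctionRat) (hMi : MilneAnyModel)
    (hMP : nonempty_modularParametrizationData) (hFH : friedbergHoffstein_exists_heegnerField_split_twist_ne_zero) :
    ∀ (W : WeierstrassCurve ℚ) [W.IsElliptic] [W.IsGloballyMinimal],
      ¬ W.HasCM → W.analyticRank = 1 → (∀ P : W.toAffine.Point, 2 • P = 0 → P = 0) → Nat.card (W.selmerGroup 2) ≠ 2 →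
        Literature.NumberTheory.EllipticCurves.BSDp W 2 :=
  shaCell_of_wall_of_friedbergHoffstein_of_kex0Sha_of_facts hGZ hGZK hLf hMi hMP hFH h1
    (kexSha_of_upper_of_lower hGZ hLf hUp (lower_of_supply_of_structure_of_sharp_of_residual hQ2 hGZ hLf hHab hS hD hRes))

/-- **THE LINE CONCLUDES THE CRUX BY NAME**: `RankOneShaCellBSDTwo` (stmt-BirchSwinnertonDyer-27477) from the seven stubs.  Sorry-free outside the
stubs; no converse used.  BSD is NOT proved by this. -/
theorem RankOneShaCellBSDTwo_of : Summit.BirchSwinnertonDyer.BirchSwinnertonDyer.Theses.GenusKolyvaginAtTwo.RankOneShaCellBSDTwo :=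
  shaCell_of_inputs
    (rankZeroBSDTwo_of_wall stub_itemsByName.1.1 stub_itemsByName.1.2.1 stub_itemsByName.1.2.2.1 stub_itemsByName.1.2.2.2)
    stub_itemsByName.2 stub_heegnerIndexUpperShaCell stub_deepWitnessSupplyNegHabitat stub_kolyvaginStructureLowerOffHabitat
    stub_sharpKolyvaginDefectOffHabitat stub_smallImageLower
    stub_printFacts.1 stub_printFacts.2.1 stub_printFacts.2.2.1 stub_printFacts.2.2.2.1 stub_printFacts.2.2.2.2.1 stub_printFacts.2.2.2.2.2

end Summit.BirchSwinnertonDyer.BirchSwinnertonDyer.Cruxes.RankOneShaCellBSDTwo.KolyvaginStructure
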